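import Literature.NumberTheory.Automorphic.ArithmeticQuotientTransfer
import Literature.NumberTheory.Automorphic.IwahoriDiagonalDecomposition
import Mathlib.GroupTheory.NoncommPiCoprod
import HarnessLib

/-!
# The diamond action of `∏_{v ∣ p} T_n(𝒪_v) / T_v(b)` on `H^i(X_{U(b,c)}, M)`

Topic `NumberTheory/Automorphic`; namespace `Literature.NumberTheory.Automorphic.BigHeckeGLn`
(and `….TameLevel`); definitions with bodies and theorems.  The group-theoretic half of the
`Λ`-module structure of Hida theory for `GL_n` over a number field ([KhareThorne2017, §6.3]: "the
action of `T_n(𝒪_{F,p})` by diamond operators makes `H^*(X_{U(b,c)}, ·)` a module over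
`𝒪[T(1)/T(b)]`"; [Hida1994AIF, §2]):

* `torusBall v b = T_v(b) ≤ T_n(𝒪_v)` — the diagonal units `≡ 1 mod ϖ_v^b` (a subgroup);
* `TameLevel.levelDiamond` — **the diamond operators `u ↦ ⟨u⟩_v = [U(b,c) ι_v(diag u) U(b,c)]`
  on `H^i(X_{U(b,c)}, M)` form a MONOID HOMOMORPHISM `T_n(𝒪_v) → End H^i`** (`U` maximal above
  `p`, `v ∣ p`; multiplicativity `HidaTowerLevelsHecke.heckeEnd_level_diamondElement_mul`),
  **trivial on `T_v(b)`** (`torusBall_le_ker_levelDiamond`), hence a homomorphism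
  `levelDiamondQuot : T_n(𝒪_v)/T_v(b) →* End H^i`; diamond operators at all places above `p`
  commute (`levelDiamond_commute`);
* `diamondPi` — the product map `∏_{v ∣ p} T_n(𝒪_v) → GL_n(𝔸^∞)`, `u ↦ ∏_v ⟨u_v⟩_v`; the image
  of `∏_v T_v(b')` is the subgroup generated by the diamond elements of radius `b'`
  (`map_diamondPi_pi_torusBall`), so (`IwahoriDiagonalDecomposition`) **every `s ∈ U(b',c)` is
  `≡ diamondPi u (mod U(b,c))` with `u ∈ ∏_v T_v(b')`** (`exists_diamondPi_mul_inv_mem_level`,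
  `b ≤ c`, `max b' c ≥ 1`) and **`diamondPi u ≡ diamondPi u' (mod U(b,c))` iff
  `u_v ≡ u'_v (mod ϖ_v^b)` for all `v`** (`diamondPi_mul_inv_mem_level_iff`):
  `U(b',c)/U(b,c) ≅ ∏_{v ∣ p} T_v(b')/T_v(b)`;
* `TameLevel.levelTorus` — the product action `∏_{v ∣ p} T_n(𝒪_v) →* End H^i(X_{U(b,c)}, M)`,
  trivial on `∏_v T_v(b)` (`levelTorus_eq_one_of_mem`), and
  `heckeEnd_diamondPi : T_{diamondPi u} = levelTorus u`;
* `TameLevel.exists_diamond_transversal` — a finite transversal `S ⊆ ∏_v T_v(b')` of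
  `U(b',c)/U(b,c)` by diamond elements (`b' ≤ b ≤ c`, `max b' c ≥ 1`), and the transfer
  identities of `ArithmeticQuotientTransfer` in diamond form: **`res ∘ tr = ∑_{u ∈ S} levelTorus u`**
  (the norm of the diamond action, `cohomologyPullback_transfer_eq_sum_levelTorus`), `res` lands in
  the diamond invariants (`levelTorus_cohomologyPullback_of_mem`), and the cokernel of `res` onto the
  invariants is killed by the index (`relIndex_smul_mem_range_cohomologyPullback_of_levelTorus`) —
  together with `tr ∘ res = [U(b',c) : U(b,c)]` (`heckeOperator₂_one_cohomologyPullback_level_apply`)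
  this is the finite-level CONTROL of [Hida1994AIF, §2] up to the index.

## References

* C. Khare, J. A. Thorne, *Potential automorphy and the Leopoldt conjecture*, Amer. J. Math. 139
  (2017), §6.3 (arXiv:1409.7007, held). [KhareThorne2017]
* H. Hida, *p-adic ordinary Hecke algebras for GL(2)*, Ann. Inst. Fourier 44 (1994), §2 (held).
  [Hida1994AIF]
-/

noncomputable section

open CategoryTheory IsDedekindDomain NumberField
open scoped NumberField

namespace Literature.NumberTheory.Automorphic.BigHeckeGLn

variable {n : ℕ} {K : Type} [Field K] [NumberField K]

/-! ### The congruence tori `T_v(b)` -/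

/-- **`T_v(b)`: the diagonal units `u ∈ T_n(𝒪_v)` with `u_j ≡ 1 mod ϖ_v^b`.**
[cite: KhareThorne2017, §6.3] -/
def torusBall (v : HeightOneSpectrum (𝓞 K)) (b : ℕ) :
    Subgroup (Fin n → (v.adicCompletionIntegers K)ˣ) where
  carrier := {u | ∀ j, Valued.v ((((u j : (v.adicCompletionIntegers K)ˣ) :
    v.adicCompletionIntegers K) : v.adicCompletion K) - 1) ≤ WithZero.exp (-(b : ℤ))}
  one_mem' j := by simp
  mul_mem' {u u'} hu hu' j := by
    have hx1 : Valued.v (((u j : (v.adicCompletionIntegers K)ˣ) : v.adicCompletionIntegers K) :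
        v.adicCompletion K) ≤ 1 := (valued_coe_units_adicCompletionIntegers v (u j)).le
    have hxy : ((((u * u') j : (v.adicCompletionIntegers K)ˣ) : v.adicCompletionIntegers K) :
        v.adicCompletion K) - 1 =
        (((u j : (v.adicCompletionIntegers K)ˣ) : v.adicCompletionIntegers K) : v.adicCompletion K) *
          ((((u' j : (v.adicCompletionIntegers K)ˣ) : v.adicCompletionIntegers K) :
            v.adicCompletion K) - 1) +
        ((((u j : (v.adicCompletionIntegers K)ˣ) : v.adicCompletionIntegers K) :
            v.adicCompletion K) - 1) := by
      rw [Pi.mul_apply, Units.val_mul, Subring.coe_mul]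
      ring
    rw [hxy]
    refine Valuation.map_add_le _ ?_ (hu j)
    rw [map_mul]
    exact (mul_le_of_le_one_left' hx1).trans (hu' j)
  inv_mem' {u} hu j := by
    have h := valued_units_inv_sub_one (valued_unitsToLocal v u j)
    rw [← Pi.inv_apply, ← map_inv] at h
    exact (le_of_eq h).trans (hu j)

/-- Membership in `T_v(b)` (definitional). [folklore] -/
theorem mem_torusBall_iff (v : HeightOneSpectrum (𝓞 K)) (b : ℕ)
    (u : Fin n → (v.adicCompletionIntegers K)ˣ) :
    u ∈ torusBall (n := n) v b ↔ ∀ j, Valued.v ((((u j : (v.adicCompletionIntegers K)ˣ) :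
      v.adicCompletionIntegers K) : v.adicCompletion K) - 1) ≤ WithZero.exp (-(b : ℤ)) :=
  Iff.rfl

/-- `T_v(0) = T_n(𝒪_v)`. [folklore] -/
theorem torusBall_zero (v : HeightOneSpectrum (𝓞 K)) : torusBall (n := n) (K := K) v 0 = ⊤ := by
  refine eq_top_iff.2 fun u _ j => ?_
  rw [Nat.cast_zero, neg_zero, WithZero.exp_zero]
  exact Valuation.map_sub_le _ (valued_coe_units_adicCompletionIntegers v (u j)).le
    (le_of_eq (map_one _))

/-- `T_v(b') ≤ T_v(b)` for `b ≤ b'`. [folklore] -/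
theorem torusBall_antitone (v : HeightOneSpectrum (𝓞 K)) {b b' : ℕ} (h : b ≤ b') :
    torusBall (n := n) (K := K) v b' ≤ torusBall v b := fun _ hu j =>
  (hu j).trans (WithZero.exp_le_exp.2 (by omega))

/-- The entries of `unitsToLocal u` are those of `u`. [folklore] -/
theorem coe_unitsToLocal_apply (v : HeightOneSpectrum (𝓞 K)) (u : Fin n → (v.adicCompletionIntegers K)ˣ)
    (j : Fin n) : ((unitsToLocal n v u j : (v.adicCompletion K)ˣ) : v.adicCompletion K) =
      (((u j : (v.adicCompletionIntegers K)ˣ) : v.adicCompletionIntegers K) : v.adicCompletion K) :=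
  rfl

/-- `u u'⁻¹ ∈ T_v(b)` iff `u_j ≡ u'_j mod ϖ_v^b`. [folklore] -/
theorem mul_inv_mem_torusBall_iff (v : HeightOneSpectrum (𝓞 K)) (b : ℕ)
    (u u' : Fin n → (v.adicCompletionIntegers K)ˣ) :
    u * u'⁻¹ ∈ torusBall (n := n) v b ↔
      ∀ j, Valued.v ((((u j : (v.adicCompletionIntegers K)ˣ) : v.adicCompletionIntegers K) :
          v.adicCompletion K) - (((u' j : (v.adicCompletionIntegers K)ˣ) :
            v.adicCompletionIntegers K) : v.adicCompletion K)) ≤ WithZero.exp (-(b : ℤ)) := by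
  refine forall_congr' fun j => ?_
  rw [← coe_unitsToLocal_apply, ← coe_unitsToLocal_apply v u, ← coe_unitsToLocal_apply v u', map_mul,
    map_inv, Pi.mul_apply, Pi.inv_apply, Units.val_mul, Units.val_inv_eq_inv_val]
  have hy := valued_unitsToLocal v u' j
  have hy0 : ((unitsToLocal n v u' j : (v.adicCompletion K)ˣ) : v.adicCompletion K) ≠ 0 :=
    (unitsToLocal n v u' j).ne_zero
  rw [show ((unitsToLocal n v u j : (v.adicCompletion K)ˣ) : v.adicCompletion K) *
      (((unitsToLocal n v u' j : (v.adicCompletion K)ˣ) : v.adicCompletion K))⁻¹ - 1 =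
      (((unitsToLocal n v u j : (v.adicCompletion K)ˣ) : v.adicCompletion K) -
        ((unitsToLocal n v u' j : (v.adicCompletion K)ˣ) : v.adicCompletion K)) *
      (((unitsToLocal n v u' j : (v.adicCompletion K)ˣ) : v.adicCompletion K))⁻¹ by
      rw [sub_mul, mul_inv_cancel₀ hy0], map_mul, map_inv₀, hy, inv_one, mul_one]

/-! ### Diamond elements commute -/

omit [NumberField K] in
/-- Diamond elements (at the same or at different places) commute. [folklore] -/
theorem commute_diamondElement [NumberField K] (v w : HeightOneSpectrum (𝓞 K))
    (u : Fin n → (v.adicCompletionIntegers K)ˣ) (u' : Fin n → (w.adicCompletionIntegers K)ˣ) :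
    Commute (diamondElement n K v u) (diamondElement n K w u') := by
  by_cases hvw : v = w
  · subst hvw
    change diamondElement n K v u * diamondElement n K v u' =
      diamondElement n K v u' * diamondElement n K v u
    rw [← map_mul, mul_comm, map_mul]
  · rw [diamondElement_apply w]
    exact mul_ofLocal_comm (by rw [diamondElement_apply, localComponent_ofLocal_of_ne (Ne.symm hvw)]) _

/-! ### The product of diamond elements over the places above `p` -/

section diamondPi

variable (K)
variable (p : ℕ) [Fact p.Prime]

/-- The places above `p` (a finite type). [folklore] -/
abbrev PlacesAbove : Type :=
  {v : HeightOneSpectrum (𝓞 K) // (p : 𝓞 K) ∈ v.asIdeal}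

/-- There are finitely many places above `p`. [folklore] -/
instance : Finite (PlacesAbove K p) :=
  finite_setOf_natCast_mem_asIdeal K p

/-- A `Fintype` structure on the places above `p`. [folklore] -/
instance : Fintype (PlacesAbove K p) :=
  Fintype.ofFinite _

variable (n)

/-- **`diamondPi : ∏_{v ∣ p} T_n(𝒪_v) → GL_n(𝔸_K^∞)`, `u ↦ ∏_v ⟨u_v⟩_v`** (the factors commute).
[cite: KhareThorne2017, §6.3] -/
def diamondPi : (∀ v : PlacesAbove K p, (Fin n → (v.1.adicCompletionIntegers K)ˣ)) →*
    FiniteAdelicGL n K :=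
  MonoidHom.noncommPiCoprod (fun v => diamondElement n K v.1)
    fun v w _ x y => commute_diamondElement v.1 w.1 x y

variable {n K p}

/-- `diamondPi` on a single factor is the diamond element. [folklore] -/
theorem diamondPi_mulSingle [DecidableEq (PlacesAbove K p)] (v : PlacesAbove K p)
    (u : Fin n → (v.1.adicCompletionIntegers K)ˣ) :
    diamondPi n K p (Pi.mulSingle v u) = diamondElement n K v.1 u := by
  rw [diamondPi, MonoidHom.noncommPiCoprod_mulSingle]

/-- **The image under `diamondPi` of `∏_{v ∣ p} T_v(b')` is the subgroup generated by the diamond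
elements `⟨u⟩_v`, `v ∣ p`, `u ≡ 1 mod ϖ_v^{b'}`.** [cite: KhareThorne2017, §6.3] -/
theorem map_diamondPi_pi_torusBall (b' : ℕ) :
    (Subgroup.pi Set.univ fun v : PlacesAbove K p => torusBall (n := n) v.1 b').map (diamondPi n K p) =
      Subgroup.closure {x : FiniteAdelicGL n K |
        ∃ (v : HeightOneSpectrum (𝓞 K)) (_ : (p : 𝓞 K) ∈ v.asIdeal)
          (u : Fin n → (v.adicCompletionIntegers K)ˣ),
          (∀ j, Valued.v ((((u j : (v.adicCompletionIntegers K)ˣ) : v.adicCompletionIntegers K) :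
            v.adicCompletion K) - 1) ≤ WithZero.exp (-(b' : ℤ))) ∧ x = diamondElement n K v u} := by
  classical
  refine le_antisymm ?_ ((Subgroup.closure_le _).2 ?_)
  · rintro x ⟨u, hu, rfl⟩
    rw [diamondPi, MonoidHom.noncommPiCoprod_apply]
    refine Subgroup.noncommProd_mem _ _ fun v _ => ?_
    exact Subgroup.subset_closure ⟨v.1, v.2, u v, hu v (Set.mem_univ _), rfl⟩
  · rintro x ⟨v, hv, u, hu, rfl⟩
    refine ⟨Pi.mulSingle (⟨v, hv⟩ : PlacesAbove K p) u, fun w _ => ?_, diamondPi_mulSingle ⟨v, hv⟩ u⟩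
    by_cases hw : w = ⟨v, hv⟩
    · subst hw
      rw [Pi.mulSingle_eq_same]
      exact hu
    · rw [Pi.mulSingle_eq_of_ne hw]
      exact (torusBall w.1 b').one_mem

/-- The local component at `w ∣ p` of `diamondPi u` is `diag(u_w)`. [folklore] -/
theorem localComponent_diamondPi (u : ∀ v : PlacesAbove K p, (Fin n → (v.1.adicCompletionIntegers K)ˣ))
    (w : PlacesAbove K p) :
    localComponent n K w.1 (diamondPi n K p u) =
      glDiagonal n (w.1.adicCompletion K) (unitsToLocal n w.1 (u w)) := by
  classical
  rw [diamondPi, MonoidHom.noncommPiCoprod_apply, Finset.map_noncommProd,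
    ← Finset.insert_erase (Finset.mem_univ w),
    Finset.noncommProd_insert_of_notMem _ _ _ _ (Finset.notMem_erase w _),
    Finset.noncommProd_eq_pow_card (Finset.univ.erase w) _ _ 1 fun x hx => ?_, one_pow, mul_one]
  · rw [diamondElement_apply, localComponent_ofLocal]
  · rw [diamondElement_apply,
      localComponent_ofLocal_of_ne (fun h => (Finset.ne_of_mem_erase hx) (Subtype.ext h.symm))]

/-- The local component away from `p` of `diamondPi u` is trivial. [folklore] -/
theorem localComponent_diamondPi_of_not_mem
    (u : ∀ v : PlacesAbove K p, (Fin n → (v.1.adicCompletionIntegers K)ˣ)) {w : HeightOneSpectrum (𝓞 K)}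
    (hw : (p : 𝓞 K) ∉ w.asIdeal) : localComponent n K w (diamondPi n K p u) = 1 := by
  classical
  rw [diamondPi, MonoidHom.noncommPiCoprod_apply, Finset.map_noncommProd,
    Finset.noncommProd_eq_pow_card Finset.univ _ _ 1 fun x _ => by
      rw [diamondElement_apply, localComponent_ofLocal_of_ne (fun h => hw (by rw [h]; exact x.2))],
    one_pow]

namespace TameLevel

variable {p : ℕ} [Fact p.Prime] (𝒰 : TameLevel n K p)

/-- `diamondPi u ∈ U(b, c)` when every `u_v ∈ T_v(b)` (`U` maximal above `p`). [folklore] -/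
theorem diamondPi_mem_level (h𝒰 : 𝒰.IsMaximalAbove) {b : ℕ} (c : ℕ)
    (u : ∀ v : PlacesAbove K p, (Fin n → (v.1.adicCompletionIntegers K)ˣ))
    (hu : ∀ v, u v ∈ torusBall v.1 b) : diamondPi n K p u ∈ 𝒰.level b c := by
  classical
  rw [diamondPi, MonoidHom.noncommPiCoprod_apply]
  refine Subgroup.noncommProd_mem _ _ fun v _ => ?_
  exact 𝒰.diamondElement_mem_level h𝒰 v.2 c (hu v)

/-- **`diamondPi u ∈ U(b, c)` iff `u_v ∈ T_v(b)` for all `v ∣ p`** (`U` maximal above `p`).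
[cite: KhareThorne2017, §6.3] -/
theorem diamondPi_mem_level_iff (h𝒰 : 𝒰.IsMaximalAbove) {b : ℕ} (c : ℕ)
    (u : ∀ v : PlacesAbove K p, (Fin n → (v.1.adicCompletionIntegers K)ˣ)) :
    diamondPi n K p u ∈ 𝒰.level b c ↔ ∀ v, u v ∈ torusBall v.1 b := by
  refine ⟨fun h v => ?_, 𝒰.diamondPi_mem_level h𝒰 c u⟩
  have h' := ((𝒰.mem_level_iff b c _).1 h).2 v.1 v.2
  rw [localComponent_diamondPi] at h'
  have h'' := (glDiagonal_mul_inv_mem_iwahoriLevel_iff v.1 b c (u v) 1).1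
    (by rwa [map_one, map_one, inv_one, mul_one])
  intro j
  simpa using h'' j

/-- **`diamondPi u ≡ diamondPi u' (mod U(b, c))` iff `u_v u'_v⁻¹ ∈ T_v(b)` for all `v ∣ p`** — the
injectivity half of `U(b', c)/U(b, c) ≅ ∏_{v ∣ p} T_v(b')/T_v(b)`. [cite: KhareThorne2017, §6.3] -/
theorem diamondPi_mul_inv_mem_level_iff (h𝒰 : 𝒰.IsMaximalAbove) {b : ℕ} (c : ℕ)
    (u u' : ∀ v : PlacesAbove K p, (Fin n → (v.1.adicCompletionIntegers K)ˣ)) :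
    diamondPi n K p u * (diamondPi n K p u')⁻¹ ∈ 𝒰.level b c ↔ ∀ v, u v * (u' v)⁻¹ ∈ torusBall v.1 b := by
  rw [← map_inv, ← map_mul, 𝒰.diamondPi_mem_level_iff h𝒰 c]
  rfl

/-- **Every `s ∈ U(b', c)` is `≡ diamondPi u (mod U(b, c))` for some `u ∈ ∏_v T_v(b')`** (`b ≤ c`,
`max b' c ≥ 1`, `U` maximal above `p`) — the surjectivity half of
`U(b', c)/U(b, c) ≅ ∏_{v ∣ p} T_v(b')/T_v(b)`. [cite: KhareThorne2017, §6.3] -/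
theorem exists_diamondPi_mul_inv_mem_level (h𝒰 : 𝒰.IsMaximalAbove) {b b' c : ℕ} (hbc : b ≤ c)
    (h1 : 1 ≤ max b' c) {s : FiniteAdelicGL n K} (hs : s ∈ 𝒰.level b' c) :
    ∃ u : ∀ v : PlacesAbove K p, (Fin n → (v.1.adicCompletionIntegers K)ˣ),
      (∀ v, u v ∈ torusBall v.1 b') ∧ s * (diamondPi n K p u)⁻¹ ∈ 𝒰.level b c := by
  obtain ⟨d, hd, hsd⟩ := 𝒰.exists_mem_closure_diamond_mul_inv_mem_level h𝒰 hbc h1 hs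
  rw [← map_diamondPi_pi_torusBall] at hd
  obtain ⟨u, hu, rfl⟩ := hd
  exact ⟨u, fun v => hu v (Set.mem_univ _), hsd⟩

/-- `diamondPi u` normalises `U(b, c)` (`U` maximal above `p`). [folklore] -/
theorem diamondPi_conj_mem_level (h𝒰 : 𝒰.IsMaximalAbove) (b c : ℕ)
    (u : ∀ v : PlacesAbove K p, (Fin n → (v.1.adicCompletionIntegers K)ˣ)) {x : FiniteAdelicGL n K}
    (hx : x ∈ 𝒰.level b c) :
    (diamondPi n K p u)⁻¹ * x * diamondPi n K p u ∈ 𝒰.level b c := by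
  classical
  -- induction over the generating diamond elements (radius `0`), with the two-sided property
  have hmem : diamondPi n K p u ∈
      (Subgroup.pi Set.univ fun v : PlacesAbove K p => torusBall (n := n) v.1 0).map (diamondPi n K p) :=
    ⟨u, fun v _ => show u v ∈ torusBall v.1 0 by rw [torusBall_zero]; exact Subgroup.mem_top _, rfl⟩
  rw [map_diamondPi_pi_torusBall] at hmem
  suffices h : (∀ y ∈ 𝒰.level b c, (diamondPi n K p u)⁻¹ * y * diamondPi n K p u ∈ 𝒰.level b c) ∧
      ∀ y ∈ 𝒰.level b c, diamondPi n K p u * y * (diamondPi n K p u)⁻¹ ∈ 𝒰.level b c from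
    h.1 x hx
  refine Subgroup.closure_induction (p := fun d _ =>
      (∀ y ∈ 𝒰.level b c, d⁻¹ * y * d ∈ 𝒰.level b c) ∧
        ∀ y ∈ 𝒰.level b c, d * y * d⁻¹ ∈ 𝒰.level b c) ?_ ?_ ?_ ?_ hmem
  · rintro d ⟨v, hv, u, -, rfl⟩
    refine ⟨fun y hy => 𝒰.diamondElement_conj_mem_level h𝒰 hv u b c hy, fun y hy => ?_⟩
    have h := 𝒰.diamondElement_conj_mem_level h𝒰 hv u⁻¹ b c hy
    rwa [map_inv, inv_inv] at h
  · exact ⟨fun y hy => by simpa using hy, fun y hy => by simpa using hy⟩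
  · rintro d e - - ⟨hd, hd'⟩ ⟨he, he'⟩
    refine ⟨fun y hy => ?_, fun y hy => ?_⟩
    · have h := he _ (hd y hy)
      rwa [mul_inv_rev, show e⁻¹ * d⁻¹ * y * (d * e) = e⁻¹ * (d⁻¹ * y * d) * e by group]
    · have h := hd' _ (he' y hy)
      rwa [mul_inv_rev, show d * e * y * (e⁻¹ * d⁻¹) = d * (e * y * e⁻¹) * d⁻¹ by group]
  · rintro d - ⟨hd, hd'⟩
    refine ⟨fun y hy => ?_, fun y hy => ?_⟩
    · rw [inv_inv]
      exact hd' y hy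
    · have h := hd y hy
      rwa [inv_inv]

end TameLevel

end diamondPi

/-! ### The diamond operators as a monoid homomorphism -/

namespace TameLevel

variable {p : ℕ} [Fact p.Prime] (𝒰 : TameLevel n K p) (h𝒰 : 𝒰.IsMaximalAbove)
  {v : HeightOneSpectrum (𝓞 K)} (hv : (p : 𝓞 K) ∈ v.asIdeal) (b c : ℕ)
  (k : Type) [CommRing k] (M : Type) [AddCommGroup M] [Module k M] (i : ℕ)

/-- **The diamond operators `⟨·⟩_v : T_n(𝒪_v) →* End H^i(X_{U(b,c)}, M)`** (`U` maximal above `p`,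
`v ∣ p`). [cite: KhareThorne2017, §6.3] -/
def levelDiamond : (Fin n → (v.adicCompletionIntegers K)ˣ) →*
    Module.End k (ArithmeticQuotient.cohomology k (globalEmbedding n K) (𝒰.level b c) M i) where
  toFun u := ArithmeticQuotient.heckeEnd k (𝒰.level b c) (diamondElement n K v u) M (globalEmbedding n K) i
  map_one' := by
    rw [map_one]
    exact ArithmeticQuotient.heckeEnd_eq_one_of_mem k (globalEmbedding n K) M (one_mem _) i
  map_mul' u u' := 𝒰.heckeEnd_level_diamondElement_mul h𝒰 hv b c u u' k M i

/-- Unfolding `levelDiamond`. [folklore] -/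
@[simp]
theorem levelDiamond_apply (u : Fin n → (v.adicCompletionIntegers K)ˣ) :
    𝒰.levelDiamond h𝒰 hv b c k M i u =
      ArithmeticQuotient.heckeEnd k (𝒰.level b c) (diamondElement n K v u) M (globalEmbedding n K) i :=
  rfl

/-- **`⟨u⟩_v = 1` on `H^i(X_{U(b,c)}, M)` for `u ∈ T_v(b)`.** [cite: KhareThorne2017, §6.3] -/
theorem levelDiamond_eq_one_of_mem {u : Fin n → (v.adicCompletionIntegers K)ˣ}
    (hu : u ∈ torusBall v b) : 𝒰.levelDiamond h𝒰 hv b c k M i u = 1 :=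
  𝒰.heckeEnd_level_diamondElement_eq_one h𝒰 hv c hu k M i

/-- `T_v(b) ≤ ker ⟨·⟩_v`. [cite: KhareThorne2017, §6.3] -/
theorem torusBall_le_ker_levelDiamond : torusBall v b ≤ (𝒰.levelDiamond h𝒰 hv b c k M i).ker :=
  fun _ hu => 𝒰.levelDiamond_eq_one_of_mem h𝒰 hv b c k M i hu

/-- **The diamond action of the finite group `T_n(𝒪_v)/T_v(b)` on `H^i(X_{U(b,c)}, M)`.**
[cite: KhareThorne2017, §6.3] -/
def levelDiamondQuot : (Fin n → (v.adicCompletionIntegers K)ˣ) ⧸ torusBall (n := n) v b →*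
    Module.End k (ArithmeticQuotient.cohomology k (globalEmbedding n K) (𝒰.level b c) M i) :=
  QuotientGroup.lift (torusBall v b) (𝒰.levelDiamond h𝒰 hv b c k M i)
    (𝒰.torusBall_le_ker_levelDiamond h𝒰 hv b c k M i)

/-- `levelDiamondQuot` on a class is the diamond operator. [folklore] -/
@[simp]
theorem levelDiamondQuot_mk (u : Fin n → (v.adicCompletionIntegers K)ˣ) :
    𝒰.levelDiamondQuot h𝒰 hv b c k M i (u : (Fin n → (v.adicCompletionIntegers K)ˣ) ⧸ torusBall v b) =
      𝒰.levelDiamond h𝒰 hv b c k M i u :=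
  rfl

/-- **Diamond operators commute** (at the same or at different places above `p`).
[cite: KhareThorne2017, §6.3] -/
theorem levelDiamond_commute {w : HeightOneSpectrum (𝓞 K)} (hw : (p : 𝓞 K) ∈ w.asIdeal)
    (u : Fin n → (v.adicCompletionIntegers K)ˣ) (u' : Fin n → (w.adicCompletionIntegers K)ˣ) :
    Commute (𝒰.levelDiamond h𝒰 hv b c k M i u) (𝒰.levelDiamond h𝒰 hw b c k M i u') := by
  change _ * _ = _ * _
  rw [levelDiamond_apply, levelDiamond_apply,
    ← ArithmeticQuotient.heckeEnd_mul_of_conj k (globalEmbedding n K) M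
      (fun x hx => 𝒰.diamondElement_conj_mem_level h𝒰 hv u b c hx)
      (fun x hx => 𝒰.diamondElement_conj_mem_level h𝒰 hw u' b c hx) i,
    (commute_diamondElement v w u u').eq,
    ArithmeticQuotient.heckeEnd_mul_of_conj k (globalEmbedding n K) M
      (fun x hx => 𝒰.diamondElement_conj_mem_level h𝒰 hw u' b c hx)
      (fun x hx => 𝒰.diamondElement_conj_mem_level h𝒰 hv u b c hx) i]

/-! ### The product action of `∏_{v ∣ p} T_n(𝒪_v)` -/

/-- **The diamond action of `∏_{v ∣ p} T_n(𝒪_v)` on `H^i(X_{U(b,c)}, M)`**, `u ↦ ∏_v ⟨u_v⟩_v`.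
[cite: KhareThorne2017, §6.3] -/
def levelTorus : (∀ w : PlacesAbove K p, (Fin n → (w.1.adicCompletionIntegers K)ˣ)) →*
    Module.End k (ArithmeticQuotient.cohomology k (globalEmbedding n K) (𝒰.level b c) M i) :=
  MonoidHom.noncommPiCoprod (fun w => 𝒰.levelDiamond h𝒰 w.2 b c k M i)
    fun w w' _ x y => 𝒰.levelDiamond_commute h𝒰 w.2 b c k M i w'.2 x y

/-- `levelTorus` on a single factor is the diamond operator. [folklore] -/
theorem levelTorus_mulSingle [DecidableEq (PlacesAbove K p)] (w : PlacesAbove K p)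
    (u : Fin n → (w.1.adicCompletionIntegers K)ˣ) :
    𝒰.levelTorus h𝒰 b c k M i (Pi.mulSingle w u) = 𝒰.levelDiamond h𝒰 w.2 b c k M i u := by
  rw [levelTorus, MonoidHom.noncommPiCoprod_mulSingle]

/-- **`levelTorus` is trivial on `∏_v T_v(b)`.** [cite: KhareThorne2017, §6.3] -/
theorem levelTorus_eq_one_of_mem (u : ∀ w : PlacesAbove K p, (Fin n → (w.1.adicCompletionIntegers K)ˣ))
    (hu : ∀ w, u w ∈ torusBall w.1 b) : 𝒰.levelTorus h𝒰 b c k M i u = 1 := by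
  classical
  rw [levelTorus, MonoidHom.noncommPiCoprod_apply]
  exact (Finset.noncommProd_eq_pow_card Finset.univ
    (fun w : PlacesAbove K p => 𝒰.levelDiamond h𝒰 w.2 b c k M i (u w)) _ 1 fun w _ =>
    𝒰.levelDiamond_eq_one_of_mem h𝒰 w.2 b c k M i (hu w)).trans (one_pow _)

/-- **`T_{diamondPi u} = ∏_v ⟨u_v⟩_v` on `H^i(X_{U(b,c)}, M)`.** [cite: KhareThorne2017, §6.3] -/
theorem heckeEnd_diamondPi (u : ∀ w : PlacesAbove K p, (Fin n → (w.1.adicCompletionIntegers K)ˣ)) :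
    ArithmeticQuotient.heckeEnd k (𝒰.level b c) (diamondPi n K p u) M (globalEmbedding n K) i =
      𝒰.levelTorus h𝒰 b c k M i u := by
  classical
  rw [diamondPi, levelTorus, MonoidHom.noncommPiCoprod_apply, MonoidHom.noncommPiCoprod_apply]
  -- induction over the finite set of places: `heckeEnd` is multiplicative on normalising elements
  suffices h : ∀ s : Finset (PlacesAbove K p),
      (∀ x ∈ 𝒰.level b c,
        (s.noncommProd (fun w => diamondElement n K w.1 (u w)) fun x _ y _ _ =>
            commute_diamondElement x.1 y.1 (u x) (u y))⁻¹ * x *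
          s.noncommProd (fun w => diamondElement n K w.1 (u w)) (fun x _ y _ _ =>
            commute_diamondElement x.1 y.1 (u x) (u y)) ∈ 𝒰.level b c) ∧
      ArithmeticQuotient.heckeEnd k (𝒰.level b c)
        (s.noncommProd (fun w => diamondElement n K w.1 (u w)) fun x _ y _ _ =>
          commute_diamondElement x.1 y.1 (u x) (u y)) M (globalEmbedding n K) i =
        s.noncommProd (fun w => 𝒰.levelDiamond h𝒰 w.2 b c k M i (u w))
          fun x _ y _ _ => 𝒰.levelDiamond_commute h𝒰 x.2 b c k M i y.2 (u x) (u y) from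
    (h Finset.univ).2
  intro s
  induction s using Finset.induction_on with
  | empty =>
    refine ⟨fun x hx => by simpa using hx, ?_⟩
    rw [Finset.noncommProd_empty, Finset.noncommProd_empty]
    exact ArithmeticQuotient.heckeEnd_eq_one_of_mem k (globalEmbedding n K) M (one_mem _) i
  | insert w s hw ih =>
    rw [Finset.noncommProd_insert_of_notMem _ _ _ _ hw, Finset.noncommProd_insert_of_notMem _ _ _ _ hw]
    have hnorm : ∀ x ∈ 𝒰.level b c, (diamondElement n K w.1 (u w))⁻¹ * x *
        diamondElement n K w.1 (u w) ∈ 𝒰.level b c := fun x hx =>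
      𝒰.diamondElement_conj_mem_level h𝒰 w.2 _ b c hx
    refine ⟨fun x hx => ?_, ?_⟩
    · have := ih.1 _ (hnorm x hx)
      simpa only [mul_inv_rev, mul_assoc] using this
    · rw [ArithmeticQuotient.heckeEnd_mul_of_conj k (globalEmbedding n K) M hnorm ih.1 i, ih.2]
      rfl

/-! ### `res ∘ tr` is the norm of the diamond action -/

/-- **A transversal of `U(b', c)/U(b, c)` by diamond elements** (`b' ≤ b ≤ c`, `max b' c ≥ 1`, `U`
maximal above `p`): a finite set `S ⊆ ∏_{v ∣ p} T_v(b')` such that `u ↦ diamondPi u · U(b,c)` is a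
bijection from `S` onto `U(b', c)/U(b, c)` (which is finite: `U(b, c)` is open and `U(b', c)`
compact). [cite: KhareThorne2017, §6.3] -/
theorem exists_diamond_transversal (h𝒰' : 𝒰.IsMaximalAbove) {b b' c : ℕ} (hbc : b ≤ c)
    (h1 : 1 ≤ max b' c) :
    ∃ S : Finset (∀ w : PlacesAbove K p, (Fin n → (w.1.adicCompletionIntegers K)ˣ)),
      (∀ u ∈ S, ∀ w, u w ∈ torusBall w.1 b') ∧
      Set.BijOn (fun u => (diamondPi n K p u : FiniteAdelicGL n K ⧸ 𝒰.level b c)) S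
        (ArithmeticQuotient.doubleCosetQuot₂ (𝒰.level b' c) (𝒰.level b c) 1) := by
  classical
  set D := ArithmeticQuotient.doubleCosetQuot₂ (𝒰.level b' c) (𝒰.level b c) (1 : FiniteAdelicGL n K)
    with hD
  have hfin : D.Finite := by
    refine Set.finite_of_ncard_ne_zero ?_
    rw [hD, ArithmeticQuotient.ncard_doubleCosetQuot₂_one]
    exact relIndex_ne_zero_of_isOpen_of_isCompact (𝒰.isOpen_level b c) (𝒰.isCompact_level b' c)
  -- every coset in `D` is the coset of some `diamondPi u`, `u ∈ ∏ T_v(b')`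
  have hrep : ∀ d ∈ D, ∃ u : ∀ w : PlacesAbove K p, (Fin n → (w.1.adicCompletionIntegers K)ˣ),
      (∀ w, u w ∈ torusBall w.1 b') ∧ (diamondPi n K p u : FiniteAdelicGL n K ⧸ 𝒰.level b c) = d := by
    intro d hd
    rw [hD, ArithmeticQuotient.doubleCosetQuot₂_one_eq_range] at hd
    obtain ⟨l, rfl⟩ := hd
    obtain ⟨u, hu, hlu⟩ := 𝒰.exists_diamondPi_mul_inv_mem_level h𝒰' hbc h1 l.2
    refine ⟨u, hu, ?_⟩
    rw [QuotientGroup.eq,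
      show (diamondPi n K p u)⁻¹ * (l : FiniteAdelicGL n K) =
        (diamondPi n K p u)⁻¹ * ((l : FiniteAdelicGL n K) * (diamondPi n K p u)⁻¹) * diamondPi n K p u by
          group]
    exact 𝒰.diamondPi_conj_mem_level h𝒰' b c u hlu
  choose! rep hrep₁ hrep₂ using hrep
  refine ⟨hfin.toFinset.image rep, fun u hu w => ?_, ⟨fun u hu => ?_, fun u hu u' hu' huu' => ?_,
    fun d hd => ?_⟩⟩
  · obtain ⟨d, hd, rfl⟩ := Finset.mem_image.1 hu
    exact hrep₁ d (hfin.mem_toFinset.1 hd) w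
  · obtain ⟨d, hd, rfl⟩ := Finset.mem_image.1 (Finset.mem_coe.1 hu)
    change (diamondPi n K p (rep d) : FiniteAdelicGL n K ⧸ 𝒰.level b c) ∈ D
    rw [hrep₂ d (hfin.mem_toFinset.1 hd)]
    exact hfin.mem_toFinset.1 hd
  · obtain ⟨d, hd, rfl⟩ := Finset.mem_image.1 (Finset.mem_coe.1 hu)
    obtain ⟨d', hd', rfl⟩ := Finset.mem_image.1 (Finset.mem_coe.1 hu')
    have h : d = d' := by
      rw [← hrep₂ d (hfin.mem_toFinset.1 hd), ← hrep₂ d' (hfin.mem_toFinset.1 hd')]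
      exact huu'
    rw [h]
  · exact ⟨rep d, Finset.mem_coe.2 (Finset.mem_image_of_mem _ (hfin.mem_toFinset.2 hd)), hrep₂ d hd⟩

open scoped Classical in
/-- A diamond transversal maps injectively to `GL_n(𝔸^∞)` and its image is a transversal in the
sense of `ArithmeticQuotientTransfer`. [folklore] -/
theorem bijOn_image_diamondPi {b b' c : ℕ}
    {S : Finset (∀ w : PlacesAbove K p, (Fin n → (w.1.adicCompletionIntegers K)ˣ))}
    (hS : Set.BijOn (fun u => (diamondPi n K p u : FiniteAdelicGL n K ⧸ 𝒰.level b c)) S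
      (ArithmeticQuotient.doubleCosetQuot₂ (𝒰.level b' c) (𝒰.level b c) 1)) :
    Set.InjOn (diamondPi n K p) S ∧
      Set.BijOn (fun s : FiniteAdelicGL n K => (s : FiniteAdelicGL n K ⧸ 𝒰.level b c))
        (S.image (diamondPi n K p)) (ArithmeticQuotient.doubleCosetQuot₂ (𝒰.level b' c) (𝒰.level b c) 1) := by
  have hinj : Set.InjOn (diamondPi n K p) S := fun u hu u' hu' h =>
    hS.injOn hu hu' (by simp only [h])
  refine ⟨hinj, fun s hs => ?_, fun s hs s' hs' h => ?_, fun d hd => ?_⟩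
  · obtain ⟨u, hu, rfl⟩ := Finset.mem_image.1 (Finset.mem_coe.1 hs)
    exact hS.mapsTo (Finset.mem_coe.2 hu)
  · obtain ⟨u, hu, rfl⟩ := Finset.mem_image.1 (Finset.mem_coe.1 hs)
    obtain ⟨u', hu', rfl⟩ := Finset.mem_image.1 (Finset.mem_coe.1 hs')
    rw [hS.injOn (Finset.mem_coe.2 hu) (Finset.mem_coe.2 hu') h]
  · obtain ⟨u, hu, rfl⟩ := hS.surjOn hd
    exact ⟨diamondPi n K p u, Finset.mem_coe.2 (Finset.mem_image_of_mem _ hu), rfl⟩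

/-- **`res ∘ tr = ∑_{u ∈ S} ∏_v ⟨u_v⟩_v` on `H^i(X_{U(b,c)}, M)`**: for `b' ≤ b ≤ c` and a diamond
transversal `S` of `U(b', c)/U(b, c)`, the composite of the transfer to level `U(b', c)` and the
pull-back is the NORM of the diamond action of `∏_v T_v(b')/T_v(b)`.
[cite: Brown1982CohomologyGroups, Ch. III, Prop. 9.5 (iii)] [cite: KhareThorne2017, §6.3] -/
theorem cohomologyPullback_transfer_eq_sum_levelTorus {b b' c : ℕ} (hb : b' ≤ b) (hbc : b ≤ c)
    {S : Finset (∀ w : PlacesAbove K p, (Fin n → (w.1.adicCompletionIntegers K)ˣ))}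
    (hS : Set.BijOn (fun u => (diamondPi n K p u : FiniteAdelicGL n K ⧸ 𝒰.level b c)) S
      (ArithmeticQuotient.doubleCosetQuot₂ (𝒰.level b' c) (𝒰.level b c) 1))
    (x : ArithmeticQuotient.cohomology k (globalEmbedding n K) (𝒰.level b c) M i) :
    (ArithmeticQuotient.cohomologyPullback k (globalEmbedding n K) M (𝒰.level_antitone hb le_rfl) i).hom
        ((ArithmeticQuotient.heckeOperator₂ k (𝒰.level b' c) (𝒰.level b c) 1 M
          (globalEmbedding n K) i).hom x) =
      ∑ u ∈ S, 𝒰.levelTorus h𝒰 b c k M i u x := by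
  classical
  obtain ⟨hinj, hS'⟩ := 𝒰.bijOn_image_diamondPi hS
  rw [ArithmeticQuotient.cohomologyPullback_heckeOperator₂_one_apply k _ _ M (globalEmbedding n K)
    (𝒰.level_antitone hb le_rfl) (fun _ hl _ hy => 𝒰.conj_mem_level hb hbc hl hy) _ hS' i x,
    Finset.sum_image hinj]
  exact Finset.sum_congr rfl fun u _ => by rw [𝒰.heckeEnd_diamondPi h𝒰 b c k M i u]

/-- **`res` lands in the invariants of the diamond action of `∏_v T_v(b')`** (`b' ≤ b ≤ c`, `U`
maximal above `p`). [cite: KhareThorne2017, §6.3] -/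
theorem levelTorus_cohomologyPullback_of_mem {b b' c : ℕ} (hb : b' ≤ b) (hbc : b ≤ c)
    (u : ∀ w : PlacesAbove K p, (Fin n → (w.1.adicCompletionIntegers K)ˣ))
    (hu : ∀ w, u w ∈ torusBall w.1 b')
    (x : ArithmeticQuotient.cohomology k (globalEmbedding n K) (𝒰.level b' c) M i) :
    𝒰.levelTorus h𝒰 b c k M i u ((ArithmeticQuotient.cohomologyPullback k (globalEmbedding n K) M
        (𝒰.level_antitone hb le_rfl) i).hom x) =
      (ArithmeticQuotient.cohomologyPullback k (globalEmbedding n K) M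
        (𝒰.level_antitone hb le_rfl) i).hom x := by
  rw [← 𝒰.heckeEnd_diamondPi h𝒰 b c k M i u]
  exact 𝒰.heckeEnd_level_cohomologyPullback_of_mem k M hb hbc
    (𝒰.diamondPi_mem_level h𝒰 c u hu) i x

/-- **The cokernel of `res : H^i(X_{U(b',c)}, M) → H^i(X_{U(b,c)}, M)^{∏ T_v(b')}` is killed by
the index `[U(b',c) : U(b,c)]`**: a class invariant under the diamond action of a diamond
transversal `S` has `[U(b',c) : U(b,c)] • y ∈ range res`.
[cite: Brown1982CohomologyGroups, Ch. III, Prop. 9.5 (iii), 10.1] [cite: Hida1994AIF, §2 (proof of Thm. 2.2)] -/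
theorem relIndex_smul_mem_range_cohomologyPullback_of_levelTorus {b b' c : ℕ} (hb : b' ≤ b)
    (hbc : b ≤ c) {S : Finset (∀ w : PlacesAbove K p, (Fin n → (w.1.adicCompletionIntegers K)ˣ))}
    (hS : Set.BijOn (fun u => (diamondPi n K p u : FiniteAdelicGL n K ⧸ 𝒰.level b c)) S
      (ArithmeticQuotient.doubleCosetQuot₂ (𝒰.level b' c) (𝒰.level b c) 1))
    {y : ArithmeticQuotient.cohomology k (globalEmbedding n K) (𝒰.level b c) M i}
    (hy : ∀ u ∈ S, 𝒰.levelTorus h𝒰 b c k M i u y = y) :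
    (𝒰.level b c).relIndex (𝒰.level b' c) • y ∈
      LinearMap.range (ArithmeticQuotient.cohomologyPullback k (globalEmbedding n K) M
        (𝒰.level_antitone hb le_rfl) i).hom := by
  classical
  obtain ⟨hinj, hS'⟩ := 𝒰.bijOn_image_diamondPi hS
  refine 𝒰.relIndex_smul_mem_range_cohomologyPullback_level k M hb hbc _ hS' i fun s hs => ?_
  obtain ⟨u, hu, rfl⟩ := Finset.mem_image.1 hs
  rw [𝒰.heckeEnd_diamondPi h𝒰 b c k M i u]
  exact hy u hu

end TameLevel

end Literature.NumberTheory.Automorphic.BigHeckeGLn
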